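import Literature.MathematicalPhysics.QuantumLattice.SpinTwistedHubbardTorus
import Literature.MathematicalPhysics.QuantumLattice.SpinGaugeTransformations
import Literature.MathematicalPhysics.QuantumLattice.MagneticHubbardTorusGauge
import Summits.HubbardSuperconductivity.HubbardSuperconductivity.Theorems.ColourTheSpinSgEndpointSpinDescent

/-!
# Crux `SgEndpoint` (stmt-HubbardSuperconductivity-16272, route `ColourTheSpin`): the large gauge
# transformation of the spin-twisted Hubbard torus and the `2π`-periodicity of its sector energies

Support file 1/2 for the SPIN-TWIST BLOCH BOUND (file 2: `ColourTheSpinSgEndpointSpinTwistBloch`),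
the unconditional half of the twist-gap hypothesis of the landed penalised endpoint
`stub_penalisedEndpoint` (= DOOR `SgEndpointP`). For the spin-twisted torus in the boost gauge
(`spinTwistedHubbardTorus L U φ`, Literature `SpinTwistedHubbardTorus`, where this transformation is
listed as "not here"):

* `Gamma_diag_mul_creation/annihilation/hop/numberOp/interaction` — intertwiners of the second
  quantisation `Γ(⊕_x diag d_x)` of a sitewise DIAGONAL spin rotation with unit-modulus phases:
  `c†_{xσ} ↦ d_x(σ) c†_{xσ}`, `c_{xσ} ↦ conj(d_x(σ)) c_{xσ}`, `n_{xσ}` and `Σ_x n_{x↑}n_{x↓}` invariant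
  (from `SpinGauged.Gamma_spinRotation_mul_creation/annihilation`);
* `Gamma_boost_mul_spinTwistedHopping`, `Gamma_boost_mul_spinTwistedHubbardTorus` — the LARGE GAUGE
  TRANSFORMATION `Γ_m = Γ(⊕_x diag(e^{2πi m x_μ/L}, e^{-2πi m x_μ/L}))`, `m ∈ ℤ`, satisfies
  `Γ_m H_L(U, φ) = H_L(U, φ − 2πm e_μ) Γ_m` (every bond in direction `μ` loses `e^{±2πi m/L}`, the
  wrap-around bond included since `e^{2πi m(L-1)/L} = e^{-2πi m/L}`);
* `minEnergyOn_spinTwistedHubbardTorus_update`, `…_two_pi_mul_int` — hence every `N`-particle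
  sector energy `minEnergyOn (H_L(U,φ)) (nParticleSubmodule N)` is `2π`-PERIODIC in each `φ_μ`, in
  particular the integer twists `2π(m₀, m₁)` are isospectral with the periodic torus `φ = 0`
  (`Γ_m` is unitary and preserves the particle number).

Sources: H. Watanabe, J. Stat. Phys. 177 (2019) 717, §2.2.3 (`U_m† H U_m = H^{(2πm/L,…)}`);
E. Lieb, T. Schultz, D. Mattis, Ann. Phys. 16 (1961) 407 (twist operator); N. Byers, C. N. Yang,
PRL 7 (1961) 46 (flux periodicity); Karakuzu–Seki–Sorella, PRB 98 (2018) 075156, Sec. II D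
(opposite spin twists, boost gauge). All statements are folklore.
-/

noncomputable section

namespace Summit.HubbardSuperconductivity.ColourTheSpin.SgEndpoint

open Matrix Finset Literature.MathematicalPhysics.QuantumLattice Literature.Probability.LatticeModels
open SpinGauged

/-! ### Sitewise diagonal spin rotations: intertwiners with `c†`, `c`, `n` -/

section Diagonal

variable {Λ : Type*} [LinearOrder Λ] [Fintype Λ] [DecidableEq Λ]

/-- A diagonal `2 × 2` matrix with unit-modulus entries is unitary. [folklore] -/
theorem diagonal_mem_unitaryGroup_of_star_mul_self {d : Fin 2 → ℂ} (hd : ∀ σ, star (d σ) * d σ = 1) :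
    Matrix.diagonal d ∈ Matrix.unitaryGroup (Fin 2) ℂ := by
  rw [Matrix.mem_unitaryGroup_iff', star_eq_conjTranspose, diagonal_conjTranspose,
    diagonal_mul_diagonal, ← diagonal_one]
  congr 1
  funext σ
  exact hd σ

/-- `Γ(⊕ diag d) c†_{xσ} = d_x(σ) c†_{xσ} Γ(⊕ diag d)`: a sitewise DIAGONAL spin rotation multiplies
each creation operator by its phase. Bratteli–Robinson II §5.2.1. [folklore] -/
theorem Gamma_diag_mul_creation (d : Λ → Fin 2 → ℂ) (x : Λ) (σ : Fin 2) :
    Gamma (spinRotation (fun y => Matrix.diagonal (d y))) * creation (orb x σ) =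
      (d x σ • creation (orb x σ)) * Gamma (spinRotation (fun y => Matrix.diagonal (d y))) := by
  rw [Gamma_spinRotation_mul_creation]
  congr 1
  refine (Finset.sum_eq_single σ (fun α _ hα => ?_) (fun h => absurd (Finset.mem_univ σ) h)).trans ?_
  · rw [diagonal_apply_ne _ hα, zero_smul]
  · rw [diagonal_apply_eq]

/-- `Γ(⊕ diag d) c_{xσ} = conj(d_x(σ)) c_{xσ} Γ(⊕ diag d)` for unit-modulus phases.
Bratteli–Robinson II §5.2.1. [folklore] -/
theorem Gamma_diag_mul_annihilation {d : Λ → Fin 2 → ℂ} (hd : ∀ y σ, star (d y σ) * d y σ = 1)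
    (x : Λ) (σ : Fin 2) :
    Gamma (spinRotation (fun y => Matrix.diagonal (d y))) * annihilation (orb x σ) =
      (star (d x σ) • annihilation (orb x σ)) *
        Gamma (spinRotation (fun y => Matrix.diagonal (d y))) := by
  have hu : ∀ y, (fun y => Matrix.diagonal (d y)) y ∈ Matrix.unitaryGroup (Fin 2) ℂ := fun y =>
    diagonal_mem_unitaryGroup_of_star_mul_self (hd y)
  rw [Gamma_spinRotation_mul_annihilation hu]
  congr 1
  refine (Finset.sum_eq_single σ (fun α _ hα => ?_) (fun h => absurd (Finset.mem_univ σ) h)).trans ?_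
  · rw [diagonal_apply_ne _ hα, star_zero, zero_smul]
  · rw [diagonal_apply_eq]

/-- `Γ (c†_{xσ} c_{yσ}) = d_x(σ) conj(d_y(σ)) · (c†_{xσ} c_{yσ}) Γ`: a hopping monomial picks up the
phase difference of its ends. [folklore] -/
theorem Gamma_diag_mul_hop {d : Λ → Fin 2 → ℂ} (hd : ∀ y σ, star (d y σ) * d y σ = 1)
    (x y : Λ) (σ : Fin 2) :
    Gamma (spinRotation (fun z => Matrix.diagonal (d z))) * (creation (orb x σ) * annihilation (orb y σ)) =
      ((d x σ * star (d y σ)) • (creation (orb x σ) * annihilation (orb y σ))) *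
        Gamma (spinRotation (fun z => Matrix.diagonal (d z))) := by
  rw [← Matrix.mul_assoc, Gamma_diag_mul_creation, Matrix.mul_assoc, Gamma_diag_mul_annihilation hd,
    ← Matrix.mul_assoc, Matrix.smul_mul, Matrix.mul_smul, smul_smul, Matrix.smul_mul]

/-- The number operators are invariant: `Γ n_{xσ} = n_{xσ} Γ`. [folklore] -/
theorem Gamma_diag_mul_numberOp {d : Λ → Fin 2 → ℂ} (hd : ∀ y σ, star (d y σ) * d y σ = 1)
    (x : Λ) (σ : Fin 2) :
    Gamma (spinRotation (fun z => Matrix.diagonal (d z))) * numberOp x σ =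
      numberOp x σ * Gamma (spinRotation (fun z => Matrix.diagonal (d z))) := by
  rw [numberOp, Gamma_diag_mul_hop hd, mul_comm (d x σ), hd, one_smul]

/-- The on-site interaction `Σ_x n_{x↑} n_{x↓}` is invariant under sitewise diagonal spin rotations.
[folklore] -/
theorem Gamma_diag_mul_interaction {d : Λ → Fin 2 → ℂ} (hd : ∀ y σ, star (d y σ) * d y σ = 1) :
    Gamma (spinRotation (fun z => Matrix.diagonal (d z))) *
        (∑ x : Λ, numberOp x 0 * numberOp x 1) =
      (∑ x : Λ, numberOp x 0 * numberOp x 1) *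
        Gamma (spinRotation (fun z => Matrix.diagonal (d z))) := by
  rw [Finset.mul_sum, Finset.sum_mul]
  refine Finset.sum_congr rfl fun x _ => ?_
  rw [← Matrix.mul_assoc, Gamma_diag_mul_numberOp hd, Matrix.mul_assoc, Gamma_diag_mul_numberOp hd,
    Matrix.mul_assoc]

/-- `Γ(⊕ diag d)` is unitary: `Γᴴ Γ = 1`. [folklore] -/
theorem Gamma_diag_conjTranspose_mul_self {d : Λ → Fin 2 → ℂ} (hd : ∀ y σ, star (d y σ) * d y σ = 1) :
    (Gamma (spinRotation (fun z => Matrix.diagonal (d z))))ᴴ *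
        Gamma (spinRotation (fun z => Matrix.diagonal (d z))) = 1 := by
  classical
  exact Gamma_spinRotation_conjTranspose_mul_self fun y =>
    diagonal_mem_unitaryGroup_of_star_mul_self (hd y)

/-- `Γ(⊕ diag d)` is unitary: `Γ Γᴴ = 1`. [folklore] -/
theorem Gamma_diag_mul_conjTranspose {d : Λ → Fin 2 → ℂ} (hd : ∀ y σ, star (d y σ) * d y σ = 1) :
    Gamma (spinRotation (fun z => Matrix.diagonal (d z))) *
        (Gamma (spinRotation (fun z => Matrix.diagonal (d z))))ᴴ = 1 := by
  classical
  exact Gamma_spinRotation_mul_conjTranspose fun y =>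
    diagonal_mem_unitaryGroup_of_star_mul_self (hd y)

end Diagonal

/-! ### Scalar phase bookkeeping -/

section Phases

open Complex in
/-- `conj(e^{ir}) e^{ir} = 1` for real `r`. [folklore] -/
theorem star_cexp_I_mul_self (r : ℝ) : star (cexp (I * r)) * cexp (I * r) = 1 := by
  rw [star_exp_I_mul_ofReal, ← Complex.exp_add, neg_add_cancel, Complex.exp_zero]

open Complex in
/-- `e^{ir₁} conj(e^{ir₂}) = e^{i(r₁ - r₂)}` for real `r₁, r₂`. [folklore] -/
theorem cexp_I_mul_star_cexp_I (r₁ r₂ : ℝ) :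
    cexp (I * r₁) * star (cexp (I * r₂)) = cexp (I * ((r₁ - r₂ : ℝ) : ℂ)) := by
  rw [star_exp_I_mul_ofReal, ← Complex.exp_add]
  congr 1
  push_cast
  ring

open Complex in
/-- `e^{ir₁} e^{ir₂} = e^{i(r₁ + r₂)}` for real `r₁, r₂`. [folklore] -/
theorem cexp_I_mul_cexp_I (r₁ r₂ : ℝ) :
    cexp (I * r₁) * cexp (I * r₂) = cexp (I * ((r₁ + r₂ : ℝ) : ℂ)) := by
  rw [← Complex.exp_add]
  congr 1
  push_cast
  ring

open Complex in
/-- Phases differing by an integer multiple of `2π` have the same exponential. [folklore] -/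
theorem cexp_I_eq_of_eq_add_int (r₁ r₂ : ℝ) (n : ℤ) (h : r₁ = r₂ + 2 * Real.pi * n) :
    cexp (I * r₁) = cexp (I * r₂) := by
  rw [h]
  push_cast
  rw [mul_add, Complex.exp_add]
  have : I * (2 * (Real.pi : ℂ) * n) = n * (2 * Real.pi * I) := by ring
  rw [this, Complex.exp_int_mul_two_pi_mul_I, mul_one]

variable {L : ℕ} [NeZero L]

/-- Shifting in direction `ν` does not change the other coordinate. [folklore] -/
theorem ofLex_shift_of_ne (x : FermionTorus 2 L) {ν μ : Fin 2} (h : ν ≠ μ) :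
    ofLex (FermionTorus.shift x ν) μ = ofLex x μ := by
  rw [FermionTorus.ofLex_shift, Function.update_of_ne (Ne.symm h)]

/-- The shifted coordinate is `x_μ + 1` minus `L` times the wrap-around indicator `k ∈ {0, 1}`.
[folklore] -/
theorem exists_val_ofLex_shift (x : FermionTorus 2 L) (μ : Fin 2) :
    ∃ k : ℤ, ((ofLex (FermionTorus.shift x μ) μ).val : ℝ) = (ofLex x μ).val + 1 - L * k := by
  have hval : (ofLex (FermionTorus.shift x μ) μ).val = ((ofLex x μ).val + 1) % L := by
    rw [FermionTorus.ofLex_shift, Function.update_self, Fin.val_add, Fin.val_one', Nat.add_mod_mod]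
  by_cases h : (ofLex x μ).val + 1 < L
  · refine ⟨0, ?_⟩
    rw [hval, Nat.mod_eq_of_lt h]
    push_cast
    ring
  · have hle : (ofLex x μ).val + 1 = L := by
      have := (ofLex x μ).isLt
      omega
    refine ⟨1, ?_⟩
    rw [hval, hle, Nat.mod_self]
    have hL : (L : ℝ) = (ofLex x μ).val + 1 := by exact_mod_cast hle.symm
    push_cast
    linarith

end Phases

/-! ### The large gauge transformation: `Γ_m H(φ) = H(φ − 2πm e_μ) Γ_m` -/

section Boost

open Complex

variable {L : ℕ} [NeZero L]

/-- **The large gauge transformation conjugates the boost-gauge hopping**: with the sitewise phases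
`d_y(σ) = e^{i(-1)^σ (2πm/L) y_μ}` (`y_μ ∈ {0,…,L-1}`, `m ∈ ℤ`),
`Γ(⊕ diag d) T_L(φ) = T_L(φ − 2πm e_μ) Γ(⊕ diag d)`: every bond in direction `μ` loses the phase
`e^{i(-1)^σ 2πm/L}`, the wrap-around bond included since `e^{2πi m (L-1)/L} = e^{-2πi m/L}`.
Watanabe (2019) §2.2.3 (`U_m† H U_m = H^{(2πm/L,…)}`). [folklore] -/
theorem Gamma_boost_mul_spinTwistedHopping (φ : Fin 2 → ℝ) (μ : Fin 2) (m : ℤ) :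
    Gamma (spinRotation (fun y : FermionTorus 2 L => Matrix.diagonal fun σ : Fin 2 =>
        cexp (I * (((-1 : ℝ) ^ (σ : ℕ) * (2 * Real.pi * m / L) * (ofLex y μ).val : ℝ) : ℂ)))) *
        spinTwistedHopping L φ =
      spinTwistedHopping L (Function.update φ μ (φ μ - 2 * Real.pi * m)) *
        Gamma (spinRotation (fun y : FermionTorus 2 L => Matrix.diagonal fun σ : Fin 2 =>
          cexp (I * (((-1 : ℝ) ^ (σ : ℕ) * (2 * Real.pi * m / L) * (ofLex y μ).val : ℝ) : ℂ)))) := by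
  set d : FermionTorus 2 L → Fin 2 → ℂ := fun y σ =>
    cexp (I * (((-1 : ℝ) ^ (σ : ℕ) * (2 * Real.pi * m / L) * (ofLex y μ).val : ℝ) : ℂ)) with hd_def
  have hd : ∀ y σ, star (d y σ) * d y σ = 1 := fun y σ => star_cexp_I_mul_self _
  change Gamma (spinRotation (fun y => Matrix.diagonal (d y))) * _ =
    _ * Gamma (spinRotation (fun y => Matrix.diagonal (d y)))
  -- the phase picked up by the bond `x → x + e_ν`, spin `σ`
  have key : ∀ (x : FermionTorus 2 L) (ν : Fin 2) (σ : Fin 2),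
      cexp (I * (((-1 : ℝ) ^ (σ : ℕ) * φ ν / L : ℝ) : ℂ)) * (d x σ * star (d (FermionTorus.shift x ν) σ)) =
        cexp (I * (((-1 : ℝ) ^ (σ : ℕ) * Function.update φ μ (φ μ - 2 * Real.pi * m) ν / L : ℝ) : ℂ)) := by
    intro x ν σ
    rw [hd_def]
    dsimp only
    rw [cexp_I_mul_star_cexp_I, cexp_I_mul_cexp_I]
    by_cases hν : ν = μ
    · subst hν
      obtain ⟨k, hk⟩ := exists_val_ofLex_shift x ν
      rw [Function.update_self]
      refine cexp_I_eq_of_eq_add_int _ _ ((-1 : ℤ) ^ (σ : ℕ) * m * k) ?_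
      rw [hk]
      have hL : (L : ℝ) ≠ 0 := Nat.cast_ne_zero.2 (NeZero.ne L)
      push_cast
      field_simp
      ring
    · rw [Function.update_of_ne hν, ofLex_shift_of_ne x hν, sub_self, add_zero]
  have key' : ∀ (x : FermionTorus 2 L) (ν : Fin 2) (σ : Fin 2),
      cexp (-(I * (((-1 : ℝ) ^ (σ : ℕ) * φ ν / L : ℝ) : ℂ))) * (d (FermionTorus.shift x ν) σ * star (d x σ)) =
        cexp (-(I * (((-1 : ℝ) ^ (σ : ℕ) * Function.update φ μ (φ μ - 2 * Real.pi * m) ν / L : ℝ) : ℂ))) := by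
    intro x ν σ
    rw [← star_exp_I_mul_ofReal, ← star_exp_I_mul_ofReal, ← key x ν σ, star_mul, star_mul, star_star]
    ring
  unfold spinTwistedHopping
  rw [Finset.mul_sum, Finset.sum_mul]
  refine Finset.sum_congr rfl fun x _ => ?_
  rw [Finset.mul_sum, Finset.sum_mul]
  refine Finset.sum_congr rfl fun ν _ => ?_
  rw [Finset.mul_sum, Finset.sum_mul]
  refine Finset.sum_congr rfl fun σ _ => ?_
  rw [Matrix.mul_add, Matrix.mul_smul, Matrix.mul_smul, Gamma_diag_mul_hop hd, Gamma_diag_mul_hop hd,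
    Matrix.add_mul, Matrix.smul_mul, Matrix.smul_mul, Matrix.smul_mul, Matrix.smul_mul, smul_smul,
    smul_smul, key x ν σ, key' x ν σ]

/-- **The large gauge transformation of the spin-twisted Hubbard torus**:
`Γ_m H_L(U, φ) = H_L(U, φ − 2πm e_μ) Γ_m` (the interaction is invariant). Watanabe (2019) §2.2.3;
Lieb–Schultz–Mattis (1961). [folklore] -/
theorem Gamma_boost_mul_spinTwistedHubbardTorus (U : ℝ) (φ : Fin 2 → ℝ) (μ : Fin 2) (m : ℤ) :
    Gamma (spinRotation (fun y : FermionTorus 2 L => Matrix.diagonal fun σ : Fin 2 =>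
        cexp (I * (((-1 : ℝ) ^ (σ : ℕ) * (2 * Real.pi * m / L) * (ofLex y μ).val : ℝ) : ℂ)))) *
        spinTwistedHubbardTorus L U φ =
      spinTwistedHubbardTorus L U (Function.update φ μ (φ μ - 2 * Real.pi * m)) *
        Gamma (spinRotation (fun y : FermionTorus 2 L => Matrix.diagonal fun σ : Fin 2 =>
          cexp (I * (((-1 : ℝ) ^ (σ : ℕ) * (2 * Real.pi * m / L) * (ofLex y μ).val : ℝ) : ℂ)))) := by
  have hd : ∀ (y : FermionTorus 2 L) (σ : Fin 2),
      star (cexp (I * (((-1 : ℝ) ^ (σ : ℕ) * (2 * Real.pi * m / L) * (ofLex y μ).val : ℝ) : ℂ))) *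
        cexp (I * (((-1 : ℝ) ^ (σ : ℕ) * (2 * Real.pi * m / L) * (ofLex y μ).val : ℝ) : ℂ)) = 1 :=
    fun y σ => star_cexp_I_mul_self _
  unfold spinTwistedHubbardTorus
  rw [Matrix.mul_add, Matrix.mul_neg, Gamma_boost_mul_spinTwistedHopping, Matrix.mul_smul,
    Gamma_diag_mul_interaction hd, Matrix.add_mul, Matrix.neg_mul, Matrix.smul_mul]

/-- **`2π`-periodicity of the sector energies**: for every integer `m`, direction `μ` and particle
number `N`, `E_N(φ − 2πm e_μ) = E_N(φ)` for the `N`-particle sector energy of the spin-twisted torus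
(`Γ_m` is unitary and preserves the particle number). Watanabe (2019) §2.2.3; Byers–Yang (1961).
[folklore] -/
theorem minEnergyOn_spinTwistedHubbardTorus_update (U : ℝ) (φ : Fin 2 → ℝ) (μ : Fin 2) (m : ℤ)
    (N : ℕ) :
    (spinTwistedHubbardTorus L U (Function.update φ μ (φ μ - 2 * Real.pi * m))).minEnergyOn
        (nParticleSubmodule N) =
      (spinTwistedHubbardTorus L U φ).minEnergyOn (nParticleSubmodule N) := by
  classical
  set d : FermionTorus 2 L → Fin 2 → ℂ := fun y σ =>
    cexp (I * (((-1 : ℝ) ^ (σ : ℕ) * (2 * Real.pi * m / L) * (ofLex y μ).val : ℝ) : ℂ)) with hd_def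
  have hd : ∀ y σ, star (d y σ) * d y σ = 1 := fun y σ => star_cexp_I_mul_self _
  set Γ := Gamma (spinRotation (fun y => Matrix.diagonal (d y))) with hΓ
  have hcomm : Γ * spinTwistedHubbardTorus L U φ =
      spinTwistedHubbardTorus L U (Function.update φ μ (φ μ - 2 * Real.pi * m)) * Γ :=
    Gamma_boost_mul_spinTwistedHubbardTorus U φ μ m
  have h1 : Γᴴ * Γ = 1 := Gamma_diag_conjTranspose_mul_self hd
  have h2 : Γ * Γᴴ = 1 := Gamma_diag_mul_conjTranspose hd
  have hconj : spinTwistedHubbardTorus L U φ =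
      Γᴴ * spinTwistedHubbardTorus L U (Function.update φ μ (φ μ - 2 * Real.pi * m)) * Γ := by
    rw [Matrix.mul_assoc, ← hcomm, ← Matrix.mul_assoc, h1, Matrix.one_mul]
  rw [hconj]
  symm
  refine Matrix.minEnergyOn_conjTranspose_mul_mul _ Γ _ h1 h2 (fun ψ hψ => ?_) (fun ψ hψ => ?_)
  · rw [mem_nParticleSubmodule_iff] at hψ ⊢
    exact isNParticle_Gamma_mulVec _ hψ
  · rw [mem_nParticleSubmodule_iff] at hψ ⊢
    rw [hΓ, ← Gamma_conjTranspose]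
    exact isNParticle_Gamma_mulVec _ hψ

/-- The sector energies at integer twists `2π(m₀, m₁)` equal those of the periodic torus `φ = 0`.
[folklore] -/
theorem minEnergyOn_spinTwistedHubbardTorus_two_pi_mul_int (U : ℝ) (m : Fin 2 → ℤ) (N : ℕ) :
    (spinTwistedHubbardTorus L U (fun ν => 2 * Real.pi * m ν)).minEnergyOn (nParticleSubmodule N) =
      (spinTwistedHubbardTorus L U 0).minEnergyOn (nParticleSubmodule N) := by
  have h0 := minEnergyOn_spinTwistedHubbardTorus_update (L := L) U (fun ν => 2 * Real.pi * m ν) 0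
    (m 0) N
  have h1 := minEnergyOn_spinTwistedHubbardTorus_update (L := L) U
    (Function.update (fun ν : Fin 2 => 2 * Real.pi * (m ν : ℝ)) 0 (2 * Real.pi * m 0 - 2 * Real.pi * m 0))
    1 (m 1) N
  have hzero : Function.update
      (Function.update (fun ν : Fin 2 => 2 * Real.pi * (m ν : ℝ)) 0 (2 * Real.pi * m 0 - 2 * Real.pi * m 0))
      1 (Function.update (fun ν : Fin 2 => 2 * Real.pi * (m ν : ℝ)) 0
        (2 * Real.pi * m 0 - 2 * Real.pi * m 0) 1 - 2 * Real.pi * m 1) = 0 := by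
    funext ν
    fin_cases ν <;> simp
  rw [hzero] at h1
  rw [← h0, ← h1]

end Boost

/-! ### Registered helper (verbatim signature) -/

section Registered

/-- Registered helper `helper_spinTwistPeriodicity` of crux item stmt-HubbardSuperconductivity-16272
(verbatim signature): the `2π`-periodicity of the `N`-sector energies of the spin-twisted torus,
`minEnergyOn_spinTwistedHubbardTorus_update`. [folklore] -/
theorem helper_spinTwistPeriodicity : ∀ (L : ℕ) [NeZero L] (U : ℝ) (φ : Fin 2 → ℝ) (μ : Fin 2) (m : ℤ) (N : ℕ), (spinTwistedHubbardTorus L U (Function.update φ μ (φ μ - 2 * Real.pi * m))).minEnergyOn (nParticleSubmodule N : Submodule ℂ (Fock (Orb (FermionTorus 2 L)))) = (spinTwistedHubbardTorus L U φ).minEnergyOn (nParticleSubmodule N : Submodule ℂ (Fock (Orb (FermionTorus 2 L)))) :=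
  fun _ _ U φ μ m N => minEnergyOn_spinTwistedHubbardTorus_update U φ μ m N

end Registered

end Summit.HubbardSuperconductivity.ColourTheSpin.SgEndpoint
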